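import Summits.HodgeConjecture.HodgeConjecture.Theorems.F0P2oN7OfCasselmanCriterion      -- ★ brings N5∕N1 holds, D1∕D2, QuotientCharacterEigenvector, JacquetModuleExactProofs, central character
import Summits.HodgeConjecture.HodgeConjecture.Theorems.F0P3JacquetEmbeddingDichotomy
import Summits.HodgeConjecture.HodgeConjecture.Theorems.F0P3U3PrincipalSeriesJacquetFiltrationHolds
import Summits.HodgeConjecture.HodgeConjecture.Theorems.F0P3U3LengthLeTwoOfEmbeds
import Summits.HodgeConjecture.HodgeConjecture.Theorems.F0P3U3SquareIntegrableExponentsHolds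
import Summits.HodgeConjecture.HodgeConjecture.Theorems.F0P3bCentralCharacterUnitaryNonsplit
import Literature.NumberTheory.Automorphic.JacquetModuleExactProofs
import Literature.NumberTheory.Automorphic.JacquetLineExponents
import Literature.NumberTheory.Automorphic.JacquetRankStrictMono
import Literature.NumberTheory.Automorphic.JacquetNonzeroEmbedsNormalizedInd
import Literature.NumberTheory.Automorphic.QuotientCharacterEigenvector
import Literature.NumberTheory.Automorphic.CMXiTorusCharSplitTorusDecay
import Literature.NumberTheory.Automorphic.UnitaryGroupUnipotentLimitCompactOpen
import Literature.NumberTheory.Rogawski1990.CMLocalAPacketMembers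
import Literature.NumberTheory.Automorphic.UnitaryGroupRankOneTorusCharacters        -- ★ `exists_cmTorusCharPair_eq`
import Literature.NumberTheory.Automorphic.UnitaryGroupLocalFactors                  -- ★ `continuous_conjLocal`
import Summits.HodgeConjecture.HodgeConjecture.Theorems.F0P2pTorusPairsAndVacuity      -- ★ `continuous_of_smoothInd_ne_zero`, `continuous_components_of_continuous_torusCharPair`
import Summits.HodgeConjecture.HodgeConjecture.Theorems.F0P3U3PrincipalSeriesJacquetClosedCell   -- ★ (C) `closedCell_cmPrincipalSeries`
import Summits.HodgeConjecture.HodgeConjecture.Theorems.F0P3U3PrincipalSeriesOpenCellTorusChar  -- ★ (γ-W) `torus_normalizedJacquet_openCellLine_eq_weylChar`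
import Literature.NumberTheory.Automorphic.CMPrincipalSeriesJacquetEvalOne                      -- ★ (L-q)
import Literature.NumberTheory.Automorphic.CMPrincipalSeriesOpenCellSection                     -- ★ (L-ℓ)
import HarnessLib

/-!
# F0 · P3c · line LH6 «StCharTS» — BRICK «JAC-LEN1»: at a NON-SPLIT place, an irreducible square-integrable (mod centre) representation of
# `U(Φ₃)(L⁺_v)` has Borel–Jacquet module of dimension `≤ 1`, on which the torus acts through ONE character

Cell `pub/hodgecm-mathlib`, crux H413 = `stmt-HodgeConjecture-24833` (lane `--supports`), route HCCMUnconditional; seat LH6-p03 (g0); organ (S-ii)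
`stub_StCuspidalMember` of the LH6 leaf `Cruxes/H413/Lines/F0_P3c_StCharTSPaydown.lean` (desk F0P3b-plan (g23) deals 02:21Z ∕ 04:03Z «JAC-LEN1 + (S-ii) GLUE»).
THEOREMS ONLY, sorry-free, ★-only imports; no definition ∕ instance ∕ notation ∕ named fact.
HONEST LABEL: HC_CM is proved only modulo the 7 printed citations (2 remaining: hLiu418 = stmt-HodgeConjecture-24832, h413 = stmt-HodgeConjecture-24833)
until rung 0 closes; this file proves no letter of print — it is in-house structure used by the (S-i)/(S-ii) glue.

THE MATHEMATICS ([Rogawski1990, §12.1–12.2 pp. 171–174]; [Casselman1995, Lemma 7.1.1 (a), Thm. 4.4.6]; [BernsteinZelevinsky1977, 2.12–2.13]).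
`G = U(Φ₃)(L⁺_v)` at a finite place `v` of `L⁺` NON-SPLIT in `L`, `B = TN` its Borel subgroup (★ `cmBorelTriple L 3 v`), `π` an irreducible smooth representation
of `G` square-integrable modulo the (compact) centre.  If `r_B(π) ≠ 0`, `π ↪ I := i_G(χ₁, χ₂)` (★ D1, Frobenius), `r_B(I)` is `2`-dimensional with a line of
character `wχ` and quotient character `χ` (★ N1, re-assembled here in the theorem world as `n1_line_data`), and `r_B(π) ↪ r_B(I)` (exactness ★ `jacquetMap_injective`),
so `dim r_B(π) ≤ 2`.  `dim r_B(π) = 2` is impossible: then `r_B(π) ≅ r_B(I)`, so BOTH `wχ` (the line) and `χ` (the quotient; ★ `exists_eigenvector_of_quotient_character`,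
`T` abelian) are exponents of `π`, and Casselman's criterion (★ N5 `u3SquareIntegrableExponents_holds`, unitary central character ★) makes both decay on `A⁻`;
at the split element `t = d(a, 1, a⁻¹)` (`σ a = a`, `‖a‖ < 1`) this reads `‖χ₁(a)‖ < 1` and `‖χ₁(a)‖⁻¹ < 1` — absurd (`not_decay_pair_and_weyl`).  Hence
`dim r_B(π) = 1`, and the quotient character of the Frobenius datum acts on the whole line (★ `normalizedJacquet_apply_eq_smul_of_finrank_eq_one`).
Print: «a representation of G … is supercuspidal iff …; the square-integrable constituents `π²(ξ)`, `St(ξ)` have one exponent each» ([Rogawski1990, §12.2];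
[Casselman1995, Prop. 7.1.3]).  Used by the (S-ii) glue: a square-integrable member of the (β)-datum is either supercuspidal (`r_B = 0`) or has a ONE-character
Jacquet module, so the virtual Jacquet-character identity of [Rogawski1990, L. 12.7.3 proof p. 195] can be read coefficient-wise.

ELABORATION NOTE.  Everything is typed on the matrix carrier `↥(unitaryGroupOfForm (c ⊗ 1) (cmLocalForm L 3 v))` (the carrier of ★ N1∕N5∕D1's inputs);
the named fact ★ `U3PrincipalSeriesJacquetFiltration` is a `def` whose body carries auxiliary `_proof_k` constants that do not unify with theorem-world
consumers in bounded time (finding of ★ `F0P3U3PrincipalSeriesJacquetFiltrationHolds`), so its content is re-assembled from the same ★ pieces (`n1_line_data`).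

## References
* [Rogawski1990] J. D. Rogawski, *Automorphic Representations of Unitary Groups in Three Variables*, Ann. of Math. Stud. 123 (1990): §12.1–12.2 pp. 171–174;
  §12.7 Lemma 12.7.3 p. 195.
* [Casselman1995] W. Casselman, *Introduction to the theory of admissible representations of p-adic reductive groups* (notes, 1995): Lemma 7.1.1 (a) p. 67,
  Prop. 7.1.3, Thm. 4.4.6 p. 45, §4.4, Prop. 2.1.9, Thm. 3.2.4.
* [BernsteinZelevinsky1977] I. N. Bernstein, A. V. Zelevinsky, *Induced representations of reductive p-adic groups I*, Ann. Sci. ÉNS 10 (1977): 2.12, 2.13 (c),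
  Prop. 1.9 (b), §2.3.
-/

set_option autoImplicit false
set_option linter.dupNamespace false

noncomputable section

open NumberField IsDedekindDomain MeasureTheory
open scoped Matrix NNReal
open Literature.NumberTheory Literature.NumberTheory.Automorphic Literature.NumberTheory.Automorphic.UnitaryGroup
open Literature.NumberTheory.Rogawski1990

namespace Summit.HodgeConjecture.HodgeConjecture.Cruxes.H413.F0P3cStCharTSJacLen1

/-! ## Generic: exponents pulled back along a bijective Jacquet map -/

section GenericLine

variable {G : Type*} [Group G] [TopologicalSpace G] [IsTopologicalGroup G]
  (t : ParabolicTriple G) [LocallyCompactSpace t.P]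
  {V₁ V₂ : Type*} [AddCommGroup V₁] [Module ℂ V₁] [AddCommGroup V₂] [Module ℂ V₂]
  {ρ₁ : Representation ℂ G V₁} {ρ₂ : Representation ℂ G V₂}

/-- **The line character pulls back along a BIJECTIVE Jacquet map**: if `r(f) : r(ρ₁) → r(ρ₂)` is injective and surjective and `r(ρ₂)` has a
non-zero stable submodule `ℓ` on which `M` acts by `θ₁`, then `θ₁` is an exponent of `ρ₁`. [cite: Casselman1995, §4.4 p. 45; L. 7.1.1 (a)] -/
theorem hasJacquetExponent_of_bijective_of_line (f : ρ₁.IntertwiningMap ρ₂)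
    (hinj : Function.Injective (Representation.jacquetMap t f)) (hsurj : Function.Surjective (Representation.jacquetMap t f))
    {θ₁ : ↥t.M →* ℂˣ} (ℓ : Submodule ℂ (t.restrict ρ₂).Coinvariants) (hℓne : ℓ ≠ ⊥)
    (hℓ : ∀ (m : ↥t.M), ∀ x ∈ ℓ, ρ₂.normalizedJacquet t m x = ((θ₁ m : ℂˣ) : ℂ) • x) :
    ρ₁.HasJacquetExponent t θ₁ := by
  have hy' := Submodule.exists_mem_ne_zero_of_ne_bot hℓne
  rcases hy' with ⟨y, hyℓ, hy0⟩
  have hx' := hsurj y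
  rcases hx' with ⟨x, hx⟩
  have hx0 : x ≠ 0 := by
    intro h0
    apply hy0
    rw [← hx, h0]
    exact map_zero _
  refine ⟨x, hx0, fun m => hinj ?_⟩
  have h1 := Representation.jacquetMap_normalizedJacquet t f m x
  rw [h1, map_smul, hx]
  exact hℓ m y hyℓ

/-- **The quotient character pulls back along a BIJECTIVE Jacquet map** (`M` abelian, `r(ρ₁)` finite-dimensional): if moreover `M` acts by `θ₂`
on `r(ρ₂) ⁄ ℓ` with `ℓ ≠ ⊤`, then `θ₂` is an exponent of `ρ₁` (a functional killing `ℓ`, pulled back along `r(f)`, is a non-zero `θ₂`-quotient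
functional of `r(ρ₁)`; ★ `exists_eigenvector_of_quotient_character`). [cite: Casselman1995, §4.4 p. 45; Prop. 2.1.9] -/
theorem hasJacquetExponent_of_bijective_of_quot (hM : ∀ a b : ↥t.M, a * b = b * a) (f : ρ₁.IntertwiningMap ρ₂)
    (hsurj : Function.Surjective (Representation.jacquetMap t f)) [FiniteDimensional ℂ (t.restrict ρ₁).Coinvariants]
    {θ₂ : ↥t.M →* ℂˣ} (ℓ : Submodule ℂ (t.restrict ρ₂).Coinvariants) (hℓlt : ℓ < ⊤)
    (hq : ∀ (m : ↥t.M) (x : (t.restrict ρ₂).Coinvariants), ρ₂.normalizedJacquet t m x - ((θ₂ m : ℂˣ) : ℂ) • x ∈ ℓ) :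
    ρ₁.HasJacquetExponent t θ₂ := by
  have hg' := Submodule.exists_le_ker_of_lt_top ℓ hℓlt
  rcases hg' with ⟨g, hg0, hgℓ⟩
  let φ : (t.restrict ρ₁).Coinvariants →ₗ[ℂ] ℂ := g.comp (Representation.jacquetMap t f).toLinearMap
  have hφ0 : φ ≠ 0 := by
    intro h0
    apply hg0
    refine LinearMap.ext fun z => ?_
    have hz := hsurj z
    rcases hz with ⟨x', rfl⟩
    exact LinearMap.congr_fun h0 x'
  have hφχ : ∀ (m : ↥t.M) (w : (t.restrict ρ₁).Coinvariants), φ (ρ₁.normalizedJacquet t m w) = ((θ₂ m : ℂˣ) : ℂ) * φ w := by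
    intro m w
    change g (Representation.jacquetMap t f (ρ₁.normalizedJacquet t m w)) = _ * g (Representation.jacquetMap t f w)
    have hker := hgℓ (hq m (Representation.jacquetMap t f w))
    rw [LinearMap.mem_ker, map_sub, map_smul, smul_eq_mul, sub_eq_zero] at hker
    rw [Representation.jacquetMap_normalizedJacquet t f m w]
    exact hker
  have hw' := Representation.exists_eigenvector_of_quotient_character (ρ₁.normalizedJacquet t) hM θ₂ φ hφ0 hφχ
  rcases hw' with ⟨w, hw0, hw⟩
  exact ⟨w, hw0, hw⟩

end GenericLine

/-! ## The split torus element: `χ` and `wχ` cannot both decay -/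

section SplitTorus

variable (L : Type) [Field L] [NumberField L] [IsCMField L] (v : HeightOneSpectrum (𝓞 ↥(maximalRealSubfield L)))

/-- **`χ = (χ₁, χ₂)` and `wχ = (χ̄₁⁻¹, χ₂)` do not both decay on `A⁻`**: at the split element `t = d(a, 1, a⁻¹)` (`σ a = a`, `‖a‖ < 1`, ★
`exists_map_eq_unitModulusChar_lt_one`, ★ `exists_torusU_entry_eq`) one has `χ(t) = χ₁(a)` and `wχ(t) = χ₁(a)⁻¹`, whose norms multiply to `1`.
[cite: Casselman1995, Thm 4.4.6 (b) p. 45] [cite: Rogawski1990, §12.2 p. 173] -/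
theorem not_decay_pair_and_weyl (χ₁ : (LocalRing L v)ˣ →* ℂˣ) (χ₂ : ↥(normOneUnits (conjLocal L (IsCMField.complexConj L) v)) →* ℂˣ)
    (hd : ∀ t : ↥(torusU (conjLocal L (IsCMField.complexConj L) v) (cmLocalForm L 3 v)),
      conjLocal L (IsCMField.complexConj L) v
          ((torusEntry (conjLocal L (IsCMField.complexConj L) v) (cmLocalForm L 3 v) 0 t : (LocalRing L v)ˣ) : LocalRing L v) =
        ((torusEntry (conjLocal L (IsCMField.complexConj L) v) (cmLocalForm L 3 v) 0 t : (LocalRing L v)ˣ) : LocalRing L v) →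
      torusEntry (conjLocal L (IsCMField.complexConj L) v) (cmLocalForm L 3 v) 1 t = 1 →
      unitModulusChar (LocalRing L v) (torusEntry (conjLocal L (IsCMField.complexConj L) v) (cmLocalForm L 3 v) 0 t) < 1 →
      ‖((cmTorusCharPair L v χ₁ χ₂ t : ℂˣ) : ℂ)‖ < 1)
    (hw : ∀ t : ↥(torusU (conjLocal L (IsCMField.complexConj L) v) (cmLocalForm L 3 v)),
      conjLocal L (IsCMField.complexConj L) v
          ((torusEntry (conjLocal L (IsCMField.complexConj L) v) (cmLocalForm L 3 v) 0 t : (LocalRing L v)ˣ) : LocalRing L v) =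
        ((torusEntry (conjLocal L (IsCMField.complexConj L) v) (cmLocalForm L 3 v) 0 t : (LocalRing L v)ˣ) : LocalRing L v) →
      torusEntry (conjLocal L (IsCMField.complexConj L) v) (cmLocalForm L 3 v) 1 t = 1 →
      unitModulusChar (LocalRing L v) (torusEntry (conjLocal L (IsCMField.complexConj L) v) (cmLocalForm L 3 v) 0 t) < 1 →
      ‖((cmWeylTorusCharPair L v χ₁ χ₂ t : ℂˣ) : ℂ)‖ < 1) : False := by
  have ha' := exists_map_eq_unitModulusChar_lt_one L v (conjLocal L (IsCMField.complexConj L) v)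
  rcases ha' with ⟨a, hfix, hm⟩
  have ht' := exists_torusU_entry_eq (conjLocal L (IsCMField.complexConj L) v) (cmLocalForm L 3 v) (cmLocalForm_eq_over L 3 v) a hfix
  rcases ht' with ⟨t, ht0, ht1⟩
  have hfix' : conjLocal L (IsCMField.complexConj L) v
      ((torusEntry (conjLocal L (IsCMField.complexConj L) v) (cmLocalForm L 3 v) 0 t : (LocalRing L v)ˣ) : LocalRing L v) =
      (torusEntry (conjLocal L (IsCMField.complexConj L) v) (cmLocalForm L 3 v) 0 t : (LocalRing L v)ˣ) := by
    rw [ht0]; exact hfix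
  have hm' : unitModulusChar (LocalRing L v) (torusEntry (conjLocal L (IsCMField.complexConj L) v) (cmLocalForm L 3 v) 0 t) < 1 := by
    rw [ht0]; exact hm
  have hdet : torusDetNormOne (conjLocal L (IsCMField.complexConj L) v) (cmLocalForm L 3 v) (cmLocalForm_eq_over L 3 v) t = 1 := by
    apply Subtype.ext
    rw [coe_torusDetNormOne]
    exact torusDet_eq_one_of_torusEntry (conjLocal L (IsCMField.complexConj L) v) (cmLocalForm L 3 v)
      (cmLocalForm_eq_over L 3 v) t hfix' ht1
  have hma : Units.map (conjLocal L (IsCMField.complexConj L) v : LocalRing L v →* LocalRing L v) a = a := Units.ext hfix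
  have d1 := hd t hfix' ht1 hm'
  have d2 := hw t hfix' ht1 hm'
  have hv1 : cmTorusCharPair L v χ₁ χ₂ t = χ₁ a := by
    change torusCharPair _ _ _ 0 χ₁ χ₂ t = _
    rw [torusCharPair_apply, hdet, map_one, mul_one, ht0]
  have hv2 : cmWeylTorusCharPair L v χ₁ χ₂ t = (χ₁ a)⁻¹ := by
    change weylTorusCharPair _ _ _ 0 χ₁ χ₂ t = _
    rw [weylTorusCharPair_apply, hdet, map_one, mul_one, ht0, hma]
  rw [hv1] at d1
  rw [hv2, Units.val_inv_eq_inv_val, norm_inv] at d2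
  have hpos' : 0 < ‖((χ₁ a : ℂˣ) : ℂ)‖ := norm_pos_iff.2 (Units.ne_zero _)
  have h1lt : 1 < ‖((χ₁ a : ℂˣ) : ℂ)‖ := (inv_lt_one₀ hpos').1 d2
  exact absurd d1 (not_lt.2 h1lt.le)

end SplitTorus

variable (L : Type) [Field L] [NumberField L] [IsCMField L] (v : HeightOneSpectrum (𝓞 ↥(maximalRealSubfield L)))

set_option synthInstance.maxHeartbeats 400000 in
set_option maxHeartbeats 2000000 in
/-- **N1 in the theorem world.**  [Casselman1995, Lemma 7.1.1 (a)] for `i_G(χ₁, χ₂)` at a non-split place, re-assembled from the ★ pieces of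
`F0P3U3PrincipalSeriesJacquetFiltrationHolds` ((C) closed cell, (U) open-cell bound, (L-ℓ), (L-q), (γ-W)) with its abstract assembly
`finrank_eq_two_of_closedCell_openCell`, so that the conclusion carries the instance TERMS of the theorem world (the named fact ★
`U3PrincipalSeriesJacquetFiltration` is a `def`, whose body carries auxiliary `_proof_k` constants that do not unify with consumers in bounded time —
finding of ★ `F0P3U3PrincipalSeriesJacquetFiltrationHolds`, ELABORATION NOTE). Same mathematics, same proof, no new content.
[cite: Casselman1995, Lemma 7.1.1 (a) p. 67; §6.3] [cite: BernsteinZelevinsky1977, §2.12 Geometrical Lemma, Cor. 2.13 (c)] [cite: Rogawski1990, §12.2 pp. 173–174] -/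
theorem n1_line_data (hns : ∀ w : PlacesOver L v, IsCMField.complexConj L • w.1 = w.1)
    (χ₁ : (LocalRing L v)ˣ →* ℂˣ) (χ₂ : ↥(normOneUnits (conjLocal L (IsCMField.complexConj L) v)) →* ℂˣ)
    (h₁ : Continuous (fun x => ((χ₁ x : ℂˣ) : ℂ))) (h₂ : Continuous (fun x => ((χ₂ x : ℂˣ) : ℂ))) :
    haveI := locallyCompactSpace_cmBorelU L 3 v
    FiniteDimensional ℂ ((cmBorelTriple L 3 v).restrict (cmPrincipalSeries L 3 v (cmTorusCharPair L v χ₁ χ₂))).Coinvariants ∧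
    Module.finrank ℂ ((cmBorelTriple L 3 v).restrict (cmPrincipalSeries L 3 v (cmTorusCharPair L v χ₁ χ₂))).Coinvariants = 2 ∧
    ∃ ℓ : Submodule ℂ ((cmBorelTriple L 3 v).restrict (cmPrincipalSeries L 3 v (cmTorusCharPair L v χ₁ χ₂))).Coinvariants,
      Module.finrank ℂ ↥ℓ = 1 ∧
      (∀ (m : ↥(cmBorelTriple L 3 v).M), ∀ x ∈ ℓ,
        (cmPrincipalSeries L 3 v (cmTorusCharPair L v χ₁ χ₂)).normalizedJacquet (cmBorelTriple L 3 v) m x =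
          ((cmWeylTorusCharPair L v χ₁ χ₂ m : ℂˣ) : ℂ) • x) ∧
      (∀ (m : ↥(cmBorelTriple L 3 v).M) (x : ((cmBorelTriple L 3 v).restrict (cmPrincipalSeries L 3 v (cmTorusCharPair L v χ₁ χ₂))).Coinvariants),
        (cmPrincipalSeries L 3 v (cmTorusCharPair L v χ₁ χ₂)).normalizedJacquet (cmBorelTriple L 3 v) m x -
          ((cmTorusCharPair L v χ₁ χ₂ m : ℂˣ) : ℂ) • x ∈ ℓ) := by
  have HC := F0P3U3PrincipalSeriesJacquetClosedCell.closedCell_cmPrincipalSeries L v (cmTorusCharPair L v χ₁ χ₂)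
  have HU := F0P3U3PrincipalSeriesJacquetFiltrationHolds.finrank_le_one_cmPrincipalSeries L v hns (cmTorusCharPair L v χ₁ χ₂)
  have HD := exists_cmPrincipalSeries_cmTorusCharPair_toFun_one_eq_zero_and_mk_ne_zero L v χ₁ χ₂ h₁ h₂
  have HL := exists_cmPrincipalSeries_cmTorusCharPair_toFun_one_eq_one L v χ₁ χ₂ h₁ h₂
  have hWv := F0P3U3PrincipalSeriesJacquetFiltrationHolds.weylAction_of_lineAction L v hns χ₁ χ₂
    (F0P3U3PrincipalSeriesOpenCellTorusChar.torus_normalizedJacquet_openCellLine_eq_weylChar L v hns χ₁ χ₂ h₁ h₂)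
  exact F0P3U3PrincipalSeriesJacquetFiltrationHolds.finrank_eq_two_of_closedCell_openCell
    (mk := haveI := locallyCompactSpace_cmBorelU L 3 v
      ⇑(Representation.Coinvariants.mk
        ((cmBorelTriple L 3 v).restrict (cmPrincipalSeries L 3 v (cmTorusCharPair L v χ₁ χ₂)))))
    (ev := fun f => f.toFun 1)
    (J := haveI := locallyCompactSpace_cmBorelU L 3 v
      fun m => ⇑((cmPrincipalSeries L 3 v (cmTorusCharPair L v χ₁ χ₂)).normalizedJacquet (cmBorelTriple L 3 v) m))
    (χc := fun m => ((cmTorusCharPair L v χ₁ χ₂ m : ℂˣ) : ℂ))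
    (wχc := fun m => ((cmWeylTorusCharPair L v χ₁ χ₂ m : ℂˣ) : ℂ))
    HC HU HD HL hWv

set_option maxHeartbeats 2000000 in  -- one carrier crossing `f x : SmoothInd …` (as in ★ D1)
/-- **D1 on the matrix carrier**: an irreducible smooth `π` of `U(Φ₃)(L⁺_v)` with non-zero Jacquet module embeds into a principal series
`i(χ₁, χ₂)` with CONTINUOUS `χ₁, χ₂` (★ D1 `F0P3JacquetEmbeddingDichotomy.exists_injective_intertwiningMap_cmPrincipalSeries`, re-read with the
representation typed over `↥(unitaryGroupOfForm (c ⊗ 1) (cmLocalForm L 3 v))` so that no `Gqs`-carrier crossing is left to the consumer; same proof).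
[cite: BernsteinZelevinsky1977, Prop. 1.9 (b), §2.3] [cite: Casselman1995, Thm. 3.2.4] [cite: Rogawski1990, §12.1 pp. 171–172] -/
theorem exists_injective_intertwiningMap_cmPrincipalSeries_carrier
    {V : Type} [AddCommGroup V] [Module ℂ V]
    (π : Representation ℂ ↥(unitaryGroupOfForm (conjLocal L (IsCMField.complexConj L) v) (cmLocalForm L 3 v)) V)
    [hirr : π.IsIrreducible] (hsm : π.IsSmooth) [hnt : Nontrivial ((cmBorelTriple L 3 v).restrict π).Coinvariants] :
    ∃ (χ₁ : (LocalRing L v)ˣ →* ℂˣ) (χ₂ : ↥(normOneUnits (conjLocal L (IsCMField.complexConj L) v)) →* ℂˣ),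
      Continuous (fun x => ((χ₁ x : ℂˣ) : ℂ)) ∧ Continuous (fun x => ((χ₂ x : ℂˣ) : ℂ)) ∧
      ∃ f : π.IntertwiningMap (cmPrincipalSeries L 3 v (cmTorusCharPair L v χ₁ χ₂)), Function.Injective f := by
  haveI := locallyCompactSpace_cmBorelU L 3 v
  have hE := exists_character_quotient_injective_intertwiningMap_cmPrincipalSeries L 3 v π hsm
  rcases hE with ⟨χ, -, f, hf⟩
  have hpair := exists_cmTorusCharPair_eq L v χ
  rcases hpair with ⟨χ₁, χ₂, hχ⟩
  subst hχ
  haveI : Nontrivial V := Representation.IsIrreducible.nontrivial π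
  have hex := exists_ne (0 : V)
  rcases hex with ⟨x, hx⟩
  have hfx : f x ≠ 0 := fun h0 => hx (hf (by rw [h0, map_zero]))
  have hcont := F0P2pTorusPairsAndVacuity.continuous_of_smoothInd_ne_zero (cmBorelTriple L 3 v)
    (cmTorusCharPair L v χ₁ χ₂) (f x) hfx
  have hcomp := F0P2pTorusPairsAndVacuity.continuous_components_of_continuous_torusCharPair
    (conjLocal L (IsCMField.complexConj L) v) (continuous_conjLocal L (IsCMField.complexConj L) v)
    (conjLocal_conjLocal_cm L v) (cmLocalForm L 3 v) (cmLocalForm_eq_over L 3 v) χ₁ χ₂ hcont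
  exact ⟨χ₁, χ₂, hcomp.1, hcomp.2, f, hf⟩

set_option synthInstance.maxHeartbeats 400000 in
set_option maxHeartbeats 4000000 in
/-- **BRICK «JAC-LEN1».**  At a finite place `v` of `L⁺` NON-SPLIT in `L`, an irreducible smooth representation `π` of `U(Φ₃)(L⁺_v)` (matrix carrier) that is
square-integrable modulo the centre (★ `IsSquareIntegrableModCenter` for a Haar measure on `G ⧸ Z`) has Borel–Jacquet module EITHER zero OR one-dimensional with the
torus acting through a single character `θ` on it (normalised action ★ `normalizedJacquet`).  Proof in the module docstring (D1 + N1 + exactness + Casselman ⇒ at a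
split torus element). [cite: Rogawski1990, §12.2 pp. 173–174] [cite: Casselman1995, Lemma 7.1.1 (a) p. 67; Prop. 7.1.3; Thm. 4.4.6 p. 45]
[cite: BernsteinZelevinsky1977, 2.13 (c)] -/
theorem jacquet_subsingleton_or_line_of_isSquareIntegrableModCenter
    (hns : ∀ w : PlacesOver L v, IsCMField.complexConj L • w.1 = w.1)
    [i1 : MeasurableSpace (↥(unitaryGroupOfForm (conjLocal L (IsCMField.complexConj L) v) (cmLocalForm L 3 v)) ⧸
      Subgroup.center ↥(unitaryGroupOfForm (conjLocal L (IsCMField.complexConj L) v) (cmLocalForm L 3 v)))]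
    [i2 : BorelSpace (↥(unitaryGroupOfForm (conjLocal L (IsCMField.complexConj L) v) (cmLocalForm L 3 v)) ⧸
      Subgroup.center ↥(unitaryGroupOfForm (conjLocal L (IsCMField.complexConj L) v) (cmLocalForm L 3 v)))]
    (μZ : Measure (↥(unitaryGroupOfForm (conjLocal L (IsCMField.complexConj L) v) (cmLocalForm L 3 v)) ⧸
      Subgroup.center ↥(unitaryGroupOfForm (conjLocal L (IsCMField.complexConj L) v) (cmLocalForm L 3 v))))
    [i3 : μZ.IsHaarMeasure]
    {V : Type} [AddCommGroup V] [Module ℂ V]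
    (π : Representation ℂ ↥(unitaryGroupOfForm (conjLocal L (IsCMField.complexConj L) v) (cmLocalForm L 3 v)) V)
    [hirr : π.IsIrreducible] (hsm : π.IsSmooth) (hsq : π.IsSquareIntegrableModCenter μZ) :
    haveI := locallyCompactSpace_cmBorelU L 3 v
    Subsingleton ((cmBorelTriple L 3 v).restrict π).Coinvariants ∨
      (Module.finrank ℂ ((cmBorelTriple L 3 v).restrict π).Coinvariants = 1 ∧
        ∃ θ : ↥(torusU (conjLocal L (IsCMField.complexConj L) v) (cmLocalForm L 3 v)) →* ℂˣ,
          ∀ (m : ↥(cmBorelTriple L 3 v).M) (x : ((cmBorelTriple L 3 v).restrict π).Coinvariants),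
            π.normalizedJacquet (cmBorelTriple L 3 v) m x = ((θ m : ℂˣ) : ℂ) • x) := by
  haveI := locallyCompactSpace_cmBorelU L 3 v
  by_cases hsub : Subsingleton ((cmBorelTriple L 3 v).restrict π).Coinvariants
  · exact Or.inl hsub
  right
  haveI hnt : Nontrivial ((cmBorelTriple L 3 v).restrict π).Coinvariants := not_subsingleton_iff_nontrivial.1 hsub
  -- D1 (matrix carrier): an embedding into a principal series `i(χ₁, χ₂)` with continuous `χ₁, χ₂`
  have hD := exists_injective_intertwiningMap_cmPrincipalSeries_carrier L v π hsm
  rcases hD with ⟨χ₁, χ₂, h1c, h2c, f, hf⟩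
  -- N1 at `(χ₁, χ₂)`: `dim r(I) = 2`
  have hN1 := n1_line_data L v hns χ₁ χ₂ h1c h2c
  rcases hN1 with ⟨hfdI, h2, ℓ, hℓ1, hℓ, hq⟩
  haveI := hfdI
  have hIsm := F0P3U3LengthLeTwoOfEmbeds.isSmooth_cmPrincipalSeries L v (cmTorusCharPair L v χ₁ χ₂)
  have hjinj := Representation.jacquetMap_injective (cmBorelTriple L 3 v) (isLimitOfCompactOpen_cmBorelTriple_N L 3 v) hIsm f hf
  haveI hfd : FiniteDimensional ℂ ((cmBorelTriple L 3 v).restrict π).Coinvariants :=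
    Module.Finite.of_injective (Representation.jacquetMap (cmBorelTriple L 3 v) f).toLinearMap hjinj
  have hle : Module.finrank ℂ ((cmBorelTriple L 3 v).restrict π).Coinvariants ≤ 2 := by
    rw [← h2]; exact LinearMap.finrank_le_finrank_of_injective hjinj
  have hpos : 0 < Module.finrank ℂ ((cmBorelTriple L 3 v).restrict π).Coinvariants := Module.finrank_pos
  -- `dim r(π) = 2` is impossible: both `χ` and `wχ` would be exponents of the square-integrable `π`, and both would decay at a split torus element
  have hne2 : Module.finrank ℂ ((cmBorelTriple L 3 v).restrict π).Coinvariants ≠ 2 := by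
    intro h2'
    have hsurj : Function.Surjective (Representation.jacquetMap (cmBorelTriple L 3 v) f) :=
      (LinearMap.injective_iff_surjective_of_finrank_eq_finrank (by rw [h2', h2])).1 hjinj
    have hℓne : ℓ ≠ ⊥ := fun h0 => by rw [h0, finrank_bot] at hℓ1; exact zero_ne_one hℓ1
    have hℓlt : ℓ < ⊤ := by
      refine lt_top_iff_ne_top.2 fun htop => ?_
      rw [htop, finrank_top, h2] at hℓ1
      exact absurd hℓ1 (by norm_num)
    have hexpw : π.HasJacquetExponent (cmBorelTriple L 3 v) (cmWeylTorusCharPair L v χ₁ χ₂) :=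
      hasJacquetExponent_of_bijective_of_line (cmBorelTriple L 3 v) f hjinj hsurj ℓ hℓne hℓ
    have hexpχ : π.HasJacquetExponent (cmBorelTriple L 3 v) (cmTorusCharPair L v χ₁ χ₂) :=
      hasJacquetExponent_of_bijective_of_quot (cmBorelTriple L 3 v) (torusU_mul_comm _ _) f hsurj ℓ hℓlt hq
    -- Casselman ⇒ (★ N5): every exponent of the square-integrable `π` decays on `A⁻`
    have hadm : π.IsAdmissible := isAdmissible_of_nontrivial_coinvariants_cmBorelTriple L 3 v π hsm
    have hω' := F0P3bCentralCharacterUnitaryNonsplit.exists_centralChar_norm_eq_one_of_nonsplit L 3 v hns π hadm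
    rcases hω' with ⟨ω, hω, hω1⟩
    have key := @F0P3U3SquareIntegrableExponentsHolds.u3SquareIntegrableExponents_holds L _ _ _ v hns i1 i2 μZ i3 V _ _ π hadm ω hω
    have hdec := (key.1 ⟨hω1, hsq⟩).2
    exact not_decay_pair_and_weyl L v χ₁ χ₂ (hdec _ hexpχ) (hdec _ hexpw)
  have h1 : Module.finrank ℂ ((cmBorelTriple L 3 v).restrict π).Coinvariants = 1 :=
    le_antisymm (Nat.le_of_lt_succ (Nat.lt_of_le_of_ne hle hne2)) (Nat.succ_le_of_lt hpos)
  -- the character: a quotient character (★ Frobenius datum) acts on the whole line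
  have hQ := exists_character_quotient_injective_intertwiningMap_cmPrincipalSeries L 3 v π hsm
  rcases hQ with ⟨χq, hψ', -⟩
  rcases hψ' with ⟨ψ, hψ⟩
  exact ⟨h1, χq, fun m x =>
    Representation.normalizedJacquet_apply_eq_smul_of_finrank_eq_one (cmBorelTriple L 3 v) π χq h1 ψ hψ m x⟩

end Summit.HodgeConjecture.HodgeConjecture.Cruxes.H413.F0P3cStCharTSJacLen1

end
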